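import Mathlib
import HarnessLib
import Summits.Langlands.Langlands.Theses.EvenArtinQuantumBoundary
import Literature.NumberTheory.Automorphic.ArtinLFunctionsRankOneMatching
import Literature.NumberTheory.GaloisRepresentations.ArtinLFunctionOffStripProofs

/-!
# Birth skeleton (BC3) for crux stmt-Langlands-3312
`Summit.Langlands.Langlands.Theses.EvenArtinQuantumBoundary.QuantumRigidity` — line `birth`

Route `route-Langlands-EvenArtinQuantumBoundary` (`closes : QuantumRigidity → GaloisBoundaryBounded →
OffEvenArtin → Langlands`). The crux QR is the route's bet: for an irreducible EVEN `σ : Γ_ℚ → GL₂(ℂ)`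
with Dirichlet coefficient sequences `a` (of `L(s,σ)`) and `b` (of `L(s,σ^∨)`), conductor
`N = artinConductorNat σ`, an admissible constant `‖c‖ = N^{-1/2}` and the FORMAL BOUNDARY FUNCTION
`B(x) = D_a(0;x) − c x⁻¹ D_b(0;−1/(Nx))` of the weight-one Lewis–Fricke transform
`ψ_N(z) = f(z) − c z⁻¹ g(−1/(Nz))` (`f = Σ_{n≥1} aₙ e(nz)`, `g = Σ bₙ e(nz)` on `ℍ`): if `B` is bounded
on every `ℚ ∩ [1/(m+2), m+2]` then `L(s,σ)` has entire continuation.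

This file concludes QR BY NAME from TWO named stubs and one theorem PROVED here, cutting the crux
along the two classical seams of the intended proof shape ("boundedness + Euler product + FE of all
twists ⟹ regularity of `ψ_N` at the cusps ⟹ (Mellin) `L(s,σ)` entire", route header NOT DECOMPOSED
YET) so that the bet is isolated in ONE stub stated entirely on the upper-half-plane side:

* `offStrip` (PROVED, not a stub — Artin–Brauer meromorphy + Artin's functional equation, now a
  theorem of the tree, `Automorphic.artin_functional_equation_holds` (Neukirch VII (12.6)), fed to
  `FramedArtinRep.exists_meromorphic_offStrip_of_isIrreducible` (Booker 2003 p. 1091: Hecke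
  `L`-functions do not vanish on `Re s = 1`, no pole at `s = 1` for irreducible `σ^∨` of dimension
  `2`)): for irreducible `σ : Γ_ℚ → GL₂(ℂ)`, `L(s,σ)` agrees on `Re s > 1` with a function
  meromorphic on `ℂ` and ANALYTIC ON THE CLOSED LEFT HALF-PLANE `Re s ≤ 0`. So every possible pole
  of `L(s,σ)` lies in `Re s > 0` (in fact in `0 < Re s < 1`) — where the cusp sees it.
* `stub_cuspRegularity` (THE BET, hardest; verbatim the hypotheses of QR): bulk quantum boundedness
  of the boundary function `B` on the rationals of compact subsets of `(0,∞)` forces boundedness of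
  the `q`-series `f(iy) = Σ_{n≥1} aₙ e^{-2πny}` down the imaginary axis to the cusp, `0 < y ≤ 1`. (On
  that axis the Fricke term `c (iy)⁻¹ g(i/(Ny))` is `O(y⁻¹ e^{-2π/(Ny)})`, so this IS boundedness of
  `ψ_N(iy)` at the cusp `0`; a pole `s₀` of `L(s,σ)` in the strip enters `f(iy)` as `y^{-s₀}`
  (Booker 2003 (2)–(4)) — the conclusion says exactly that no such term is present. In the
  automorphic case it holds: `f(iy) = L(0,σ)·[σ(c) = −I] + O(y^{1/2})` by shifting the
  Mellin–Barnes integral.) This is where "no mechanism is known" lives (item why-might-fail: `B`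
  records only the `s = 0` constant terms at the rational cusps; the polar terms are invisible to
  it) — now as one sharp statement in the harmonic analysis of `q`-series with Euler-product
  coefficients: HORIZONTAL boundary regularity at rationals ⟹ VERTICAL boundedness at the cusp.
* `stub_mellinAtCusp` (THEOREM — Hecke's Mellin transform at the cusp; Lewis–Zagier 2001 Ch. I §1
  in the weight-one normalisation; size M–L, not in the tree or Mathlib): for ANY `a : ℕ → ℂ` whose
  Dirichlet series converges absolutely on `Re s > 1`, continues meromorphically to `ℂ` with no pole
  on `Re s ≤ 0`, and whose exponential series `Σ_{n≥1} aₙ e^{-2πny}` stays bounded as `y → 0⁺`: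
  `Σ aₙ n^{-s}` is entire. Proof shape: `(2π)^{-s} Γ(s) L(s,a) = ∫₀^∞ F(y) y^{s-1} dy` on `Re s > 1`;
  `F = O(1)` at `0` and `O(e^{-2πy})` at `∞`, so the Mellin transform is holomorphic on `Re s > 0`
  (Mathlib `mellin_differentiableAt_of_isBigO_rpow`); divide by `Γ` (`1/Γ` entire,
  `Complex.differentiable_one_div_Gamma`); glue with the left-half-plane continuation along
  `Re s = 0` by the identity principle (cf. `LFunctions.eq_of_meromorphicOn_of_eqOn`,
  `LFunctions.exists_entire_eq_of_functionalEquation` for the gluing pattern).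

Shape (for `ledger skeleton check` / `#h21_check_skeleton`): each stub is `theorem stub_<name> (binders)
: <conclusion> := by sorry` over EXISTING declarations only (Mathlib `LSeries`, `LSeriesSummable`,
`MeromorphicOn`, `AnalyticAt`, `tsum`, `Real.exp`; Literature `FramedArtinRep`, `artinLFunction`,
`FramedRep.dual`, `GaloisRep.artinConductorNat`, `IsComplexConjugation`, `LFunction.HasEntireContinuation`);
`_Goal.stub_<name> : Prop := type_of% @stub_<name>` names that statement; the composition
`QuantumRigidity_of (h₂ : _Goal.stub_cuspRegularity) (h₃ : _Goal.stub_mellinAtCusp) : QuantumRigidity`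
is proved WITHOUT `sorry` (off-strip regularity by `offStrip`; absolute convergence of `Σ aₙ n^{-s}` on
`Re s > 1` by the proved Literature theorem `FramedArtinRep.eq_of_LSeries_eq_artinLFunction_two`,
Deligne–Serre 1974 §9) and concludes the route decl BY NAME; the last `example` feeds the two stubs
to it. (An earlier draft carried off-strip regularity as a third stub `stub_offStrip`; since
`artin_functional_equation_holds` landed it is a three-line consequence of the tree, so it is proved
here instead of registered — a one-line stub would be bookkeeping.)

Disproof used: none on file (`ledger crux ls stmt-Langlands-3312`: no `Disproof.lean`, no Negative lemmas,
2026-08-17). Degenerate cases checked: `a 0`, `b 0` are junk in QR (the coefficient hypotheses ignore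
`n = 0`) — every `q`-series here kills the `n = 0` term; odd `σ` is excluded by `heven` exactly as in QR;
the hypotheses of `stub_cuspRegularity` are satisfiable up to `hbd` (coefficient sequences exist by
`FramedArtinRep.exists_LSeries_eq_artinLFunction_two`, the regularised twist values by
`Automorphic.booker_additiveTwist_meromorphic_holds`, so `B|ℚ>0` is determined by `(a,b,c)`), and `hbd`
is exactly the open `GaloisBoundaryBounded` — no vacuity; the `tsum` in the cusp condition is a genuine
sum (`|aₙ| ≤ d(n)`).
-/

set_option linter.dupNamespace false

noncomputable section

namespace Summit.Langlands.Langlands.Cruxes.QuantumRigidity.Birth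

open Summit.Langlands.Langlands.Theses.EvenArtinQuantumBoundary
open Literature.NumberTheory.GaloisRepresentations

/-! ## 0. Off-strip regularity (PROVED from the tree) -/

/-- **Off-strip regularity of `L(s,σ)` on the closed left half-plane** (Brauer 1947 meromorphy,
Artin's functional equation `Λ(1-s,σ) = W Λ(s,σ^∨)` — tree theorem
`Automorphic.artin_functional_equation_holds`, Neukirch VII (12.6) — and regularity of `Λ(s,σ^∨)` on
`Re s ≥ 1`: Hecke `L`-functions do not vanish on `Re s = 1` and the pole at `s = 1` has multiplicity
`⟨χ_{σ^∨}, 1⟩ = 0` for irreducible `σ` of dimension `2`; then divide by `A^{s/2} γ(σ,s)`, `1/γ` entire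
— tree theorem `FramedArtinRep.exists_meromorphic_offStrip_of_isIrreducible`). For irreducible
`σ : Γ_ℚ → GL₂(ℂ)` some `D`, meromorphic on `ℂ` and analytic at every `s` with `Re s ≤ 0`, agrees with
`L(s,σ)` (tree `artinLFunction`, the full Euler product) on `Re s > 1`. Evenness is not needed.
[cite: Booker2003, p. 1091 and Lemma 1 p. 1092] [cite: NeukirchANT1999, VII §12 Thm. (12.6)] -/
theorem offStrip (σ : FramedArtinRep ℚ 2) (hirr : σ.toGaloisRep.IsIrreducible) :
    ∃ D : ℂ → ℂ, MeromorphicOn D Set.univ ∧ (∀ s : ℂ, s.re ≤ 0 → AnalyticAt ℂ D s) ∧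
      ∀ s : ℂ, 1 < s.re → D s = artinLFunction σ.toArtinRep s := by
  obtain ⟨D, hDm, hDan, hDL⟩ := FramedArtinRep.exists_meromorphic_offStrip_of_isIrreducible σ hirr
    one_lt_two (Literature.NumberTheory.Automorphic.artin_functional_equation_holds σ)
  exact ⟨D, fun z _ => hDm z, fun s hs => hDan s (Or.inl hs), hDL⟩

/-! ## 1. The two stubs -/

/-- **STUB 1 — THE BET: bulk quantum boundedness ⟹ boundedness at the cusp.** Hypotheses verbatim
those of `QuantumRigidity`: `σ` irreducible and even, `a`, `b` with `Σ aₙ n^{-s} = L(s,σ)`,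
`Σ bₙ n^{-s} = L(s,σ^∨)` on `Re s > 1`, `‖c‖ = N^{-1/2}` (`N = artinConductorNat σ`), `B` the formal
boundary function of the weight-one Lewis–Fricke transform, `B(x) = D_a(0;x) − c x⁻¹ D_b(0;−1/(Nx))` at
every rational `x > 0` (regularised values of the additive twists at `s = 0`, Booker 2003 Lemma 1 /
`LFunctions.LSeries.HasAddTwistValue` by `Iff.rfl`), bounded on every `ℚ ∩ [1/(m+2), m+2]`.
CONCLUSION: the `q`-series of `σ` is bounded down the imaginary axis to the cusp,
`sup_{0<y≤1} |Σ_{n≥1} aₙ e^{-2πny}| < ∞` — equivalently (the Fricke term `c (iy)⁻¹ g(i/(Ny))` being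
`O(y⁻¹ e^{-2π/(Ny)})`) `ψ_N(iy) = f(iy) − c (iy)⁻¹ g(i/(Ny))` is bounded at the cusp `0`. A pole `s₀` of
`L(s,σ)` with `0 < Re s₀ < 1` would enter `f(iy)` as `y^{-s₀}` (Booker 2003, (2)–(4)); in the
automorphic case the conclusion holds (`f(iy) = L(0,a)·[σ(c) = −I] + O(y^{1/2})`). Intended mechanism
(route header): `B` bounded + Euler product + the functional equations of all twists ⟹ `ψ_N` extends
across `ℝ_{>0}` as a period-like function with controlled behaviour at the cusps (Lewis–Zagier), the
Galois-to-quantum converse that no source proves. Why it might fail: `B` records only the `s = 0`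
constant terms at the rational cusps, the polar terms are invisible to it (item why-might-fail); for
coefficient sequences without Euler product the implication is false. Size: open (the crux's content).
[cite: Booker2003, eqs. (2)–(4) p. 1090–1091, Lemma 1 p. 1092, `f₀` p. 1095]
[cite: LewisZagier2001, Ch. I §1] [cite: Zagier2010QMF, pp. 28–29] -/
theorem stub_cuspRegularity (σ : FramedArtinRep ℚ 2) (a b : ℕ → ℂ) (c : ℂ) (B : ℚ → ℂ)
    (hirr : σ.toGaloisRep.IsIrreducible)
    (heven : ∀ (φ : ℚ →+* ℝ) (c : Field.absoluteGaloisGroup ℚ), IsComplexConjugation φ c →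
      Matrix.GeneralLinearGroup.det (σ c) = 1)
    (ha : ∀ s : ℂ, 1 < s.re → LSeries a s = artinLFunction σ.toArtinRep s)
    (hb : ∀ s : ℂ, 1 < s.re →
      LSeries b s = artinLFunction (FramedArtinRep.toArtinRep (FramedRep.dual σ)) s)
    (hc : ‖c‖ = ((GaloisRep.artinConductorNat σ.toGaloisRep : ℕ) : ℝ) ^ (-(1 / 2 : ℝ)))
    (hB : ∀ x : ℚ, 0 < x → ∃ u v : ℂ,
      (∃ D : ℂ → ℂ, MeromorphicOn D Set.univ ∧ AnalyticAt ℂ D 0 ∧ D 0 = u ∧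
        ∀ s : ℂ, 1 < s.re → D s = LSeries (fun n : ℕ => a n *
          Complex.exp (2 * Real.pi * Complex.I * (n : ℂ) * ((x : ℚ) : ℂ))) s) ∧
      (∃ D : ℂ → ℂ, MeromorphicOn D Set.univ ∧ AnalyticAt ℂ D 0 ∧ D 0 = v ∧
        ∀ s : ℂ, 1 < s.re → D s = LSeries (fun n : ℕ => b n *
          Complex.exp (2 * Real.pi * Complex.I * (n : ℂ) *
            (((-1 / ((GaloisRep.artinConductorNat σ.toGaloisRep : ℕ) * x)) : ℚ) : ℂ))) s) ∧
      B x = u - c * ((x : ℚ) : ℂ)⁻¹ * v)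
    (hbd : ∀ m : ℕ, ∃ M : ℝ, ∀ x : ℚ, (1 : ℚ) / (m + 2) ≤ x → x ≤ m + 2 → ‖B x‖ ≤ M) :
    ∃ M : ℝ, ∀ y : ℝ, 0 < y → y ≤ 1 →
      ‖∑' n : ℕ, (if n = 0 then (0 : ℂ) else a n * (Real.exp (-(2 * Real.pi * n * y)) : ℂ))‖ ≤ M := by
  sorry

/-- **STUB 2 — Mellin transform at the cusp** (Hecke 1936; Lewis–Zagier 2001 Ch. I §1 at weight one;
THEOREM, size M–L): let `a : ℕ → ℂ` have absolutely convergent Dirichlet series on `Re s > 1`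
(`LSeriesSummable`), suppose `Σ aₙ n^{-s}` agrees on `Re s > 1` with a function meromorphic on `ℂ` and
analytic at every `s` with `Re s ≤ 0`, and suppose the exponential series `F(y) = Σ_{n≥1} aₙ e^{-2πny}`
is bounded for `0 < y ≤ 1`. Then `Σ aₙ n^{-s}` has entire continuation. Proof shape:
`(2π)^{-s} Γ(s) L(s,a) = ∫₀^∞ F(y) y^{s-1} dy` for `Re s > 1` (Fubini by absolute convergence; Mathlib
`mellin`, `Complex.integral_cpow_mul_exp_neg_mul_Ioi` / `hasMellin_one_div_const_add`-style term-wise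
evaluation); `F = O(1)` at `0⁺` (hypothesis) and `|F(y)| ≤ C e^{-2πy}` for `y ≥ 1`, so `mellin F` is
holomorphic on `Re s > 0` (`mellin_differentiableAt_of_isBigO_rpow`); `1/Γ` is entire
(`Complex.differentiable_one_div_Gamma`), so `L(s,a)` continues holomorphically to `Re s > 0`; glue with
the given continuation, analytic on `Re s ≤ 0`, across `Re s = 0` by the identity principle on
`{Re s > 0}` (cf. `LFunctions.eq_of_meromorphicOn_of_eqOn`, `LFunctions.exists_entire_eq_of_functionalEquation`
for the pattern). No Euler product, no functional equation used.
[cite: LewisZagier2001, Ch. I §1] [cite: Booker2003, Lemma 4 p. 1095 (Mellin inversion step)] -/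
theorem stub_mellinAtCusp (a : ℕ → ℂ) (hsum : ∀ s : ℂ, 1 < s.re → LSeriesSummable a s)
    (hleft : ∃ D : ℂ → ℂ, MeromorphicOn D Set.univ ∧ (∀ s : ℂ, s.re ≤ 0 → AnalyticAt ℂ D s) ∧
      ∀ s : ℂ, 1 < s.re → D s = LSeries a s)
    (hcusp : ∃ M : ℝ, ∀ y : ℝ, 0 < y → y ≤ 1 →
      ‖∑' n : ℕ, (if n = 0 then (0 : ℂ) else a n * (Real.exp (-(2 * Real.pi * n * y)) : ℂ))‖ ≤ M) :
    LFunction.HasEntireContinuation (LSeries a) := by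
  sorry

/-! ## 2. The stub statements as named propositions (the composition's hypotheses, by name)

`_Goal.stub_x` is literally `type_of% @stub_x`: no text duplicated, no `sorry` inherited (a type mentions
no proof); `#h21_check_skeleton` accepts the hypotheses of `QuantumRigidity_of` by the stub names they
carry, while audits listing this file's declarations by short name find the `stub_*` THEOREMS. -/

namespace _Goal

/-- The statement of `stub_cuspRegularity`, as a named `Prop` (literally its type). [folklore] -/
def stub_cuspRegularity : Prop :=
  type_of% @Summit.Langlands.Langlands.Cruxes.QuantumRigidity.Birth.stub_cuspRegularity

/-- The statement of `stub_mellinAtCusp`, as a named `Prop` (literally its type). [folklore] -/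
def stub_mellinAtCusp : Prop :=
  type_of% @Summit.Langlands.Langlands.Cruxes.QuantumRigidity.Birth.stub_mellinAtCusp

end _Goal

/-! ## 3. The composition (kernel-checked, no `sorry`): OFF-STRIP → CUSP → MELLIN → QR by name -/

/-- **QR from the two stubs.** Given the data of `QuantumRigidity`: (1) `offStrip` (proved) puts every
possible pole of `L(s,σ)` in `Re s > 0` (transported to `Σ aₙ n^{-s}` along `ha`); (2) absolute
convergence of `Σ aₙ n^{-s}` on `Re s > 1` is the proved Literature theorem
`FramedArtinRep.eq_of_LSeries_eq_artinLFunction_two` (`|aₙ| ≤ d(n)`, Deligne–Serre 1974 §9); (3) the bet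
`stub_cuspRegularity` turns bounded `B` into boundedness of `f(iy)` at the cusp; (4) `stub_mellinAtCusp`
makes `Σ aₙ n^{-s}` entire, hence `L(s,σ)` (they agree on `Re s > 1`). The hypotheses are, by name, the
statements of the two stubs; the conclusion is the route decl. [folklore] -/
theorem QuantumRigidity_of (h₂ : _Goal.stub_cuspRegularity) (h₃ : _Goal.stub_mellinAtCusp) :
    QuantumRigidity := by
  intro σ a b c B hirr heven ha hb hc hB hbd
  -- (1) off-strip regularity of `L(s,σ)` on `Re s ≤ 0` (PROVED), read on the Dirichlet series of `a`
  obtain ⟨D, hDm, hDan, hDL⟩ := offStrip σ hirr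
  have hleft : ∃ D : ℂ → ℂ, MeromorphicOn D Set.univ ∧ (∀ s : ℂ, s.re ≤ 0 → AnalyticAt ℂ D s) ∧
      ∀ s : ℂ, 1 < s.re → D s = LSeries a s :=
    ⟨D, hDm, hDan, fun s hs => by rw [hDL s hs, ha s hs]⟩
  -- (2) absolute convergence of `Σ aₙ n^{-s}` on `Re s > 1` (proved: Deligne–Serre §9, `|aₙ| ≤ d(n)`)
  have hsum : ∀ s : ℂ, 1 < s.re → LSeriesSummable a s := by
    obtain ⟨a', -, -, -, -, -, h⟩ := FramedArtinRep.eq_of_LSeries_eq_artinLFunction_two σ ha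
    exact fun s hs => (h s hs).1
  -- (3) THE BET: bulk boundedness of `B` ⟹ boundedness of `f(iy)` at the cusp
  have hcusp : ∃ M : ℝ, ∀ y : ℝ, 0 < y → y ≤ 1 →
      ‖∑' n : ℕ, (if n = 0 then (0 : ℂ) else a n * (Real.exp (-(2 * Real.pi * n * y)) : ℂ))‖ ≤ M :=
    h₂ σ a b c B hirr heven ha hb hc hB hbd
  -- (4) Mellin at the cusp: `Σ aₙ n^{-s}` is entire, hence so is `L(s,σ)`
  obtain ⟨g, hg, hga⟩ := h₃ a hsum hleft hcusp
  exact ⟨g, hg, fun s hs => (hga s hs).trans (ha s hs)⟩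

/-- By-name sanity check (an `example`, not a declaration of the file): the two stubs feed the
composition as they stand. -/
example : QuantumRigidity :=
  QuantumRigidity_of stub_cuspRegularity stub_mellinAtCusp

end Summit.Langlands.Langlands.Cruxes.QuantumRigidity.Birth

end
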